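import Summits.BirchSwinnertonDyer.Rank1Residual.GaloisImage.MultiplicativeCartanNormalizer
import Summits.BirchSwinnertonDyer.Rank1Residual.X11b.MultiplicativeDivisibility
import Literature.NumberTheory.EllipticCurves.BalakrishnanEtAl2019.SplitCartanImages
import Literature.NumberTheory.EllipticCurves.ComplexMultiplicationNotSemistable
import HarnessLib

/-!
# BSD rank-≤1 residual cell: `ρ̄_{E,p}` is SURJECTIVE at every MULTIPLICATIVE prime `p ≥ 11`
# with `E[p]` irreducible (Serre 1972 + Bilu–Parent–Rebolledo 2013 / BDMTV 2019) — the
# "no divisibility source" family of class X11 lives only at `p ∈ {5, 7}`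

HONEST FRAMING (cell `b2b-bsdres-*`, run/shared/lean/b2b/bsd-rank1-residual/, verbatim): the goal
of the cell is to DELETE the COMBINATION-SHAPED residual classes for ALL analytic-rank `≤ 1` elliptic
curves over `ℚ` — "full BSD formula for every rank `≤ 1` curve in class C" assembled STRICTLY from
published theorems — so that the rank-`≤ 1` remainder becomes exactly the CONSTRUCTION-SHAPED
classes, which are TYPED (missing-input Props), NOT attempted; this is not "finishing BSD".
Prove what is provable now; shrink each hard class to its core with data; no claim beyond stated
classes. Unit `b2b-bsdres-x11c` (gen 7). Theorems only (no definition, no named fact minted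
here). NO label changes: X11a / X11b keep their labels; what moves is ONE hypothesis — at a
multiplicative `p ≥ 11` the binder `Surj W p` of the cell's per-pair and chain theorems is a
THEOREM from `Irr W p` and ONE published named fact.

## The published input (one named fact, ALREADY in the tree — nothing minted here)

`BalakrishnanEtAl2019.thm12_not_le_normalizer_splitCartan`
(`Literature/NumberTheory/EllipticCurves/BalakrishnanEtAl2019/SplitCartanImages.lean`, vendored by
the x9 seat for the good-ORDINARY analogue `Rank1Residual/X9ImageShape.lean`): for `E/ℚ` without
CM and a prime `p > 7`, in every frame `(e, Φ)` of `E[p]` and for every `P ∈ GL₂(𝔽_p)`, the image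
`Φ(ρ̄_{E,p}(Γ_ℚ))` is NOT contained in the normaliser of the split Cartan subgroup `P (* 0; 0 *) P⁻¹`
— Balakrishnan–Dogra–Müller–Tuitman–Vonk, Ann. of Math. 189 (2019) Thm. 1.2 ("only if" half),
i.e. Bilu–Parent–Rebolledo, Ann. Inst. Fourier 63 (2013) Cor. 1.2 for `p ≥ 11`, `p ≠ 13` plus
BDMTV Thm. 1.1 at `13`.  Taken as a HYPOTHESIS `hB` (named-fact discipline).  The present file is
the MULTIPLICATIVE twin of `X9ImageShape.lean` (same inertia shape `(χ *; 0 1)` at `p`, Serre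
§1.11 ordinary ↔ §1.12 multiplicative), which is why the two residual families "irreducible,
non-surjective" — X9 at good ordinary `p`, and the (ram)-free part of X11 at multiplicative `p` —
are both supported at `p ∈ {5, 7}` only.

## What this file proves

* **`surj_of_mult_of_irr_of_eleven_le`** — `hB →` for `p ≥ 11`: `Mult W p → Irr W p → Surj W p`:
  otherwise `exists_le_normalizer_splitCartan_of_mult_of_irr_of_not_surj` (companion file
  `MultiplicativeCartanNormalizer.lean`: Serre 1972 §1.12 + Props. 14/15/17, tree theorems) puts
  the image in some `N(P (* 0; 0 *) P⁻¹)`, contradicting `hB` since a curve with a multiplicative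
  prime has no CM (`not_mult_of_hasCM`, *ATAEC* II.6.4).
* **`eq_five_or_eq_seven_of_mult_of_irr_of_not_surj`** — `hB →` at a multiplicative `p ≥ 5`,
  `Irr ∧ ¬Surj` forces `p = 5 ∨ p = 7`: the unit's RESISTANT family ("no divisibility source":
  `irr ∧ ¬surj ∧ ¬ram`, the multiplicative analogue of X9) is confined to `p ∈ {5, 7}` at EVERY
  conductor (data, Cremona `N < 5·10⁵`: all `64` rank-one instances and all `130` instances of any
  rank have `p = 5`, images `5S4`/`5Ns`; none at `7`).
* Class corollaries (no label change): `ClassX11b.surj_of_eleven_le`, `ClassX11a.surj_of_eleven_le`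
  (x11a's chain `X11a.forall_bsdp_of_facts … → Surj W p → …` has its `Surj` binder discharged at
  `p ≥ 11`; its "non-surjective leaf" is EMPTY there), `ClassX11.surj_of_eleven_le`.
* **`X11b.multDivisibilityAt_of_eleven_le`** — at a multiplicative `p ≥ 11` the unit's typed
  missing input `X11b.MultDivisibilityAt W p` (gen 5) follows from the THREE published
  divisibilities with NO image hypothesis at all: reducible ⇒ Greenberg–Vatsal/Wuthrich Thm. 16
  (`h16`), irreducible ⇒ surjective (this file) ⇒ Kato–Wuthrich (`hK`); so the `p`-adic
  certificate consumers `X11b.bsdp_of_multDivisibilityAt_{split,nonsplit}_of_certificate` need,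
  at `p ≥ 11`, only published facts + the two-number certificate + `p ∤ #Ш_an`.  The typed Prop
  remains a genuine input only at `p ∈ {5, 7}` (the 3 resistant pairs `84960d1, 296240ce1,
  304560by1 @5`).
* `X11b.bsdp_of_certificate_{split,nonsplit}_of_eleven_le` — the composed per-pair consumers at a
  multiplicative `p ≥ 11`, analytic rank `≤ 1` (either rank): published facts (`hJ hH hGZK h16 hK hB`)
  + the two-number certificate + `p ∤ #Ш_an` ⟹ `BSDp W p`, with NO Galois-image, (ram) or
  semistability hypothesis.  Per pair; not class theorems.

## References

* [SerreInventiones1972] J.-P. Serre, Invent. Math. 15 (1972), §1.12, §2.2, §2.4, §2.7.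
* [BiluParentRebolledo2013] Yu. Bilu, P. Parent, M. Rebolledo, Ann. Inst. Fourier 63 (2013), Cor. 1.2.
* [BalakrishnanEtAl2019] J. S. Balakrishnan, N. Dogra, J. S. Müller, J. Tuitman, J. Vonk,
  Ann. of Math. 189 (2019), Thms. 1.1, 1.2.
* [SilvermanATAEC1994] J. H. Silverman, *Advanced Topics*, II.6.4 (CM ⇒ potentially good reduction).
* [Wuthrich2014] C. Wuthrich, Doc. Math. 19 (2014), Thm. 3 / Cor. 19 (Kato's divisibility, surjective case), Thm. 16.
-/

noncomputable section

open scoped Classical NumberField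
open IsDedekindDomain Field Matrix NumberField
open WeierstrassCurve Literature.NumberTheory.EllipticCurves Literature.NumberTheory.GaloisRepresentations
  Literature.NumberTheory.GaloisRepresentations.Serre1972 Rat.HeightOneSpectrum
  Literature.NumberTheory.EllipticCurves.Rank1Residual Literature.NumberTheory.EllipticCurves.Wuthrich2014
  Literature.NumberTheory.EllipticCurves.BalakrishnanEtAl2019

namespace Summit.BirchSwinnertonDyer.Rank1Residual.GaloisImage

variable (W : WeierstrassCurve ℚ) [W.IsElliptic] (p : ℕ) [hp : Fact p.Prime]

/-! ### Surjectivity at every multiplicative `p ≥ 11` -/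

/-- **`Mult ∧ Irr ⟹ Surj` at every prime `p ≥ 11`** (from the named fact `hB` = BDMTV 2019 Thm.
1.2 / Bilu–Parent–Rebolledo 2013 Cor. 1.2).  Otherwise, in a frame `(e, Φ)` of `E[p]`
(`exists_frame_galoisRepTorsion_rat`) the image lies in the normaliser of a split Cartan subgroup
`P (* 0; 0 *) P⁻¹` (`exists_le_normalizer_splitCartan_of_mult_of_irr_of_not_surj`, `p ≥ 7`), which
`hB` forbids for a non-CM curve at `p > 7` — and a curve with a multiplicative prime has no CM
(`not_mult_of_hasCM`, *ATAEC* II.6.4).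
[cite: BalakrishnanEtAl2019, §1 Thm. 1.2 (arXiv:1711.05846 p. 2)] [cite: BiluParentRebolledo2013, Cor. 1.2]
[cite: SerreInventiones1972, §1.12, §2.2 Prop. 14, §2.7 Prop. 17] -/
theorem surj_of_mult_of_irr_of_eleven_le (hB : thm12_not_le_normalizer_splitCartan) (h11 : 11 ≤ p)
    (hmult : Mult W p) (hirr : Irr W p) : Surj W p := by
  by_contra hns
  have hCM : ¬ W.HasCM := fun hCM ↦ not_mult_of_hasCM W hCM p hmult
  obtain ⟨e, Φ, he, -⟩ := exists_frame_galoisRepTorsion_rat W p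
  obtain ⟨P, -, hGN, -⟩ :=
    exists_le_normalizer_splitCartan_of_mult_of_irr_of_not_surj W p Φ e he (by omega) hmult hirr hns
  exact hB W p hCM (by omega) Φ e he P hGN

/-- **The "no divisibility source" family lives at `p ∈ {5, 7}`**: at a multiplicative prime
`p ≥ 5` with `E[p]` irreducible and `ρ̄_{E,p}` NOT onto, `p = 5` or `p = 7` (given `hB`).  This
is the structural reason the unit's RESISTANT list (`irr ∧ ¬surj ∧ ¬ram` at a multiplicative
`p ≥ 5`; all `64` rank-one Cremona instances have `p = 5`) cannot grow beyond `p = 7` at any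
conductor. [cite: BalakrishnanEtAl2019, §1 Thm. 1.2 (arXiv:1711.05846 p. 2)] -/
theorem eq_five_or_eq_seven_of_mult_of_irr_of_not_surj (hB : thm12_not_le_normalizer_splitCartan)
    (h5 : 5 ≤ p) (hmult : Mult W p) (hirr : Irr W p) (hns : ¬ Surj W p) : p = 5 ∨ p = 7 := by
  have hpp : p.Prime := hp.out
  by_contra hne
  have h57 : p ≠ 5 ∧ p ≠ 7 := not_or.mp hne
  have h11 : 11 ≤ p := by
    -- the primes in `[5, 11)` are `5` and `7`
    by_contra hlt
    have hlt' : p < 11 := by omega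
    interval_cases p <;> simp_all (config := {decide := true})
  exact hns (surj_of_mult_of_irr_of_eleven_le W p hB h11 hmult hirr)

end Summit.BirchSwinnertonDyer.Rank1Residual.GaloisImage

/-! ### Class corollaries (labels unchanged) -/

namespace Summit.BirchSwinnertonDyer.Rank1Residual

open GaloisImage

variable (W : WeierstrassCurve ℚ) [W.IsElliptic] [W.IsGloballyMinimal] (p : ℕ) [hp : Fact p.Prime]

omit [W.IsGloballyMinimal] in
/-- **X11b at `p ≥ 11`: `ρ̄_{E,p}` is onto** (`ClassX11b = r = 1 ∧ p ≠ 2 ∧ Mult ∧ Irr`).  So on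
X11b ∧ `p ≥ 11` the surjective branch of every per-pair theorem of the cell is available (Kato's
divisibility A32); the (ram)-free, non-surjective sub-family is empty there.  Label unchanged.
[cite: BalakrishnanEtAl2019, §1 Thm. 1.2 (arXiv:1711.05846 p. 2)] -/
theorem ClassX11b.surj_of_eleven_le (hB : thm12_not_le_normalizer_splitCartan) (hX : ClassX11b W p)
    (h11 : 11 ≤ p) : Surj W p :=
  surj_of_mult_of_irr_of_eleven_le W p hB h11 hX.2.2.1 hX.2.2.2

/-- **X11a at `p ≥ 11`: `ρ̄_{E,p}` is onto** (`ClassX11a = r = 0 ∧ p ≠ 2 ∧ Mult ∧ Irr ∧ ¬Ram`):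
the `Surj W p` binder of x11a's chain (`X11a.forall_bsdp_of_facts … → 5 ≤ p → Surj W p → …`) is a
theorem at `p ≥ 11`; the chain's non-surjective leaf is empty there.  Label unchanged.
[cite: BalakrishnanEtAl2019, §1 Thm. 1.2 (arXiv:1711.05846 p. 2)] -/
theorem ClassX11a.surj_of_eleven_le (hB : thm12_not_le_normalizer_splitCartan) (hX : ClassX11a W p)
    (h11 : 11 ≤ p) : Surj W p :=
  surj_of_mult_of_irr_of_eleven_le W p hB h11 hX.2.2.1 hX.2.2.2.1

/-- **The tree's v3 class X11 at `p ≥ 11`: `ρ̄_{E,p}` is onto** (`ClassX11 = Mult ∧ Irr ∧ (…)`).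
[cite: BalakrishnanEtAl2019, §1 Thm. 1.2 (arXiv:1711.05846 p. 2)] -/
theorem ClassX11.surj_of_eleven_le (hB : thm12_not_le_normalizer_splitCartan) (hX : ClassX11 W p)
    (h11 : 11 ≤ p) : Surj W p :=
  surj_of_mult_of_irr_of_eleven_le W p hB h11 hX.1 hX.2.1

end Summit.BirchSwinnertonDyer.Rank1Residual

/-! ### The unit's typed divisibility input is PUBLISHED at every multiplicative `p ≥ 11` -/

namespace Summit.BirchSwinnertonDyer.Rank1Residual.X11b

open scoped MatrixGroups ModularForm
open GaloisImage CongruenceSubgroup Literature.NumberTheory.EllipticCurves.ModularForms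
  Literature.NumberTheory.EllipticCurves.Rank1Residual.Typed
  Literature.NumberTheory.EllipticCurves.SteinWuthrich2013

variable {W : WeierstrassCurve ℚ} [W.IsElliptic] [W.IsGloballyMinimal] {p : ℕ} [hp : Fact p.Prime]

/-- **`MultDivisibilityAt W p` from PUBLISHED facts alone at every multiplicative `p ≥ 11`, with
NO hypothesis on `ρ̄_{E,p}`.**  Case split on `E[p]`: reducible ⇒ Greenberg–Vatsal / Wuthrich
2014 Thm. 16 (`h16`, `multDivisibilityAt_of_red`); irreducible ⇒ SURJECTIVE at `p ≥ 11`
(`surj_of_mult_of_irr_of_eleven_le`, named fact `hB`) ⇒ Kato–Wuthrich (`hK`,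
`multDivisibilityAt_of_surj`).  Hence the cell's certificate consumers
`bsdp_of_multDivisibilityAt_{split,nonsplit}_of_certificate` need, at `p ≥ 11`, only published
facts + the per-pair two-number certificate + `p ∤ #Ш_an`; the typed Prop is a genuine (unpublished)
input only at `p ∈ {5, 7}`.  Per pair; NOT a class theorem; X11b's label unchanged.
[cite: Wuthrich2014, Thm. 3 / Cor. 19 and Thm. 16] [cite: BalakrishnanEtAl2019, §1 Thm. 1.2 (arXiv:1711.05846 p. 2)] -/
theorem multDivisibilityAt_of_eleven_le (h16 : thm16_charIdeal_dvd_multiplicative_of_reducible)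
    (hK : kato_charIdeal_dvd_multiplicative_of_surjective) (hB : thm12_not_le_normalizer_splitCartan)
    (h11 : 11 ≤ p) (hmult : Mult W p) : MultDivisibilityAt W p := by
  by_cases hirr : Irr W p
  · exact multDivisibilityAt_of_surj hK (by omega) hmult
      (surj_of_mult_of_irr_of_eleven_le W p hB h11 hmult hirr)
  · exact multDivisibilityAt_of_red h16 (by omega) hmult hirr

/-- **At a multiplicative `p ≥ 11`, analytic rank `≤ 1`, SPLIT case: PUBLISHED facts + the two-number
`p`-adic certificate + `p ∤ #Ш_an` ⟹ `BSD(E,p)` — no hypothesis on `ρ̄_{E,p}`, no (ram) prime, no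
semistability, either rank.**  `bsdp_of_multDivisibilityAt_split_of_certificate` with its only
non-published, non-computational input `MultDivisibilityAt W p` discharged by
`multDivisibilityAt_of_eleven_le`.  Per pair (the certificate is per pair); NOT a class theorem;
labels unchanged. [cite: SteinWuthrich2013, Thm. 6.1 (p. 20) and §4.2]
[cite: Wuthrich2014, Thm. 3 / Cor. 19 and Thm. 16] [cite: BalakrishnanEtAl2019, §1 Thm. 1.2 (arXiv:1711.05846 p. 2)] -/
theorem bsdp_of_certificate_split_of_eleven_le (hJ : thm61_splitMultiplicative)
    (hH : exists_isSplitMultCanonical) (hGZK : rank_eq_analyticRank_of_analyticRank_le_one)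
    (h16 : thm16_charIdeal_dvd_multiplicative_of_reducible)
    (hK : kato_charIdeal_dvd_multiplicative_of_surjective) (hB : thm12_not_le_normalizer_splitCartan)
    (W : WeierstrassCurve ℚ) [W.IsElliptic] [W.IsGloballyMinimal] (p : ℕ) [Fact p.Prime]
    {κ : ZpExtension ℚ p} {γ : Field.absoluteGaloisGroup ℚ} {N : ℕ} [NeZero N]
    {f : CuspForm (Gamma0 N) 2} (h11 : 11 ≤ p) (hmult : Mult W p) (hr : W.analyticRank ≤ 1)
    (Dq : TateParameterData W p)
    (hκ : κ.IsCyclotomic) (hγ : κ.IsTopGenerator γ) (hγ' : IsCyclotomicVariable p γ)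
    (hf : IsNewformOf W f) (D : W.SelmerDualData κ γ) (ϖ : ℚ) (hϖ0 : ϖ ≠ 0)
    (hϖ : (ϖ : ℝ) * W.realPeriodRat = plusPeriod f)
    (L : PowerSeries ℚ_[p]) (hL : IsSplitMultPAdicLFunctionOf f p L)
    (hordL : L.order = (W.mordellWeilRank + 1 : ℕ))
    (hcert : ∀ Dh : PAdicHeightData W p, IsSplitMultCanonical Dh Dq →
      (((ϖ : ℚ) : ℚ_[p]) * PowerSeries.coeff (W.mordellWeilRank + 1) L *
          (padicLog p (cyclotomicGenerator p) ^ (W.mordellWeilRank + 1) *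
            (W.torsionOrder : ℚ_[p]) ^ 2)).valuation =
        (LInvariant Dq * (W.tamagawaProduct : ℚ_[p]) * padicRegulator Dh).valuation)
    {s : ℚ} (hs : shaAn W = (s : ℂ)) (hv : padicValRat p s = 0) : BSDp W p :=
  bsdp_of_multDivisibilityAt_split_of_certificate hJ hH hGZK W p (by omega) hr
    (multDivisibilityAt_of_eleven_le h16 hK hB h11 hmult) Dq hκ hγ hγ' hf D ϖ hϖ0 hϖ L hL hordL
    hcert hs hv

/-- **The same, NON-split multiplicative `p ≥ 11`** (`e = 0`, `ε_p = 2`). Per pair; labels unchanged.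
[cite: SteinWuthrich2013, Thm. 6.1 (p. 20), §3.1 (p. 9) and §4.2]
[cite: Wuthrich2014, Thm. 3 / Cor. 19 and Thm. 16] [cite: BalakrishnanEtAl2019, §1 Thm. 1.2 (arXiv:1711.05846 p. 2)] -/
theorem bsdp_of_certificate_nonsplit_of_eleven_le (hJ : thm61_nonsplitMultiplicative)
    (hH : exists_isMultCanonical) (hGZK : rank_eq_analyticRank_of_analyticRank_le_one)
    (h16 : thm16_charIdeal_dvd_multiplicative_of_reducible)
    (hK : kato_charIdeal_dvd_multiplicative_of_surjective) (hB : thm12_not_le_normalizer_splitCartan)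
    (W : WeierstrassCurve ℚ) [W.IsElliptic] [W.IsGloballyMinimal] (p : ℕ) [Fact p.Prime]
    {κ : ZpExtension ℚ p} {γ : Field.absoluteGaloisGroup ℚ} {N : ℕ} [NeZero N]
    {f : CuspForm (Gamma0 N) 2} (h11 : 11 ≤ p) (hmult : Mult W p) (hr : W.analyticRank ≤ 1)
    (hns : ¬ W.HasSplitMultiplicativeReductionAtPrime p)
    {q : ℚ_[p]} (hq0 : q ≠ 0) (hq1 : ‖q‖ < 1) (hqj : tateJ q = (W.j : ℚ_[p]))
    (hκ : κ.IsCyclotomic) (hγ : κ.IsTopGenerator γ) (hγ' : IsCyclotomicVariable p γ)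
    (hf : IsNewformOf W f) (D : W.SelmerDualData κ γ) (ϖ : ℚ) (hϖ0 : ϖ ≠ 0)
    (hϖ : (ϖ : ℝ) * W.realPeriodRat = plusPeriod f)
    (L : PowerSeries ℚ_[p]) (hL : IsMultPAdicLFunctionOf f p (-1) L)
    (hordL : L.order = (W.mordellWeilRank : ℕ))
    (hcert : ∀ Dh : PAdicHeightData W p, IsMultCanonical Dh q →
      (((ϖ : ℚ) : ℚ_[p]) * PowerSeries.coeff W.mordellWeilRank L *
          (padicLog p (cyclotomicGenerator p) ^ W.mordellWeilRank *
            (W.torsionOrder : ℚ_[p]) ^ 2)).valuation =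
        (2 * (W.tamagawaProduct : ℚ_[p]) * padicRegulator Dh).valuation)
    {s : ℚ} (hs : shaAn W = (s : ℂ)) (hv : padicValRat p s = 0) : BSDp W p :=
  bsdp_of_multDivisibilityAt_nonsplit_of_certificate hJ hH hGZK W p (by omega) hr
    (multDivisibilityAt_of_eleven_le h16 hK hB h11 hmult) hmult hns hq0 hq1 hqj hκ hγ hγ' hf D ϖ
    hϖ0 hϖ L hL hordL hcert hs hv

end Summit.BirchSwinnertonDyer.Rank1Residual.X11b

end
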